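import Literature.NumberTheory.Automorphic.UnitaryGroupTruncatedKernelClassHyperbolic
import HarnessLib

/-!
# A unipotent element `≠ 1` of `U(J₃)(F)` lies in exactly one rational Borel subgroup
(Rogawski, *Automorphic Representations of Unitary Groups in Three Variables* (1990), Prop. 3.9.1 p. 32
and Prop. 7.2.1 pp. 91–92: «every unipotent element in `G` is conjugate to an element of `N`», and, in the
proof of Prop. 7.2.1, «`h` lies in `B`. For if `h ∉ B`, then `h = bwb′` … and `h⁻¹Nh ∩ N = w⁻¹Nw ∩ N = {1}`.
Hence `δ` is unique modulo `B_γ`»; here for the CENTRAL class `γ = z · 1`, `z ∈ E¹`, where `B_γ = B`.)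

Topic `NumberTheory/Automorphic`; namespace `Literature.NumberTheory.Automorphic.UnitaryGroup`. THEOREMS ONLY
over accepted tree modules (no definition, no named fact, no instance, no notation, no `sorry`). Setting:
the quasi-split unitary group `U(J₃)` of a quadratic extension `E/F` with involution `c` (`c * c = 1`),
`J₃ = antidiag(1,1,1)`, its rational points `G(F) = (quasiSplit F E c 3).arithmeticSubgroup` and rational
Borel subgroup `B(F) = arithmeticBorel F E c 3` (★ `UnitaryGroupBorelTruncation`; `B` = the stabiliser of the
isotropic line `F e₃` acting on ROW vectors, ★ `mem_borelAdelic_toAdelic_of_lastRow_eq_smul`). This is the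
ALGEBRAIC HALF of the unfolding of Arthur's truncated class kernel `k^T_𝔬` at the class
`𝔬 = {γ ∈ G(F) : charpoly γ = (X − z)³}` = `z · 𝒰(F)` (`z ∈ E¹`, `𝒰` the unipotent variety) — item (L5-i)
«the unipotent term `P_{z·𝒰}`» of the T1-qs LAW 5 road of `Cruxes/H413/Lines/F0_T1InnerFormTraceIdentity.lean`
(cell `pub/hodgecm-mathlib`, crux H413): the map `(B(F)δ, n) ↦ δ⁻¹ n δ`, `n ∈ z·N(F) ∖ {z}`, is a bijection
onto `𝔬 ∖ {z}`, which is what turns `Σ_{γ ∈ 𝔬} f(x⁻¹ γ x)` into `f(z) + Σ_{δ ∈ B(F)\G(F)} Σ_{u ∈ N(F), u ≠ 1}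
f(x⁻¹ δ⁻¹ z u δ x)` [Rogawski1990, Prop. 7.2.1]. Proofs are Bruhat-free: instead of `h⁻¹Nh ∩ N = {1}` we use
that a non-trivial element of `z · N(F)` fixes EXACTLY ONE isotropic line.

* §1 **`exists_isotropic_vecMul_eq_smul_of_charpoly_eq`** — a rational `γ ≠ z·1` with `charpoly γ = (X − z)³`,
  `z ∈ E¹`, has a non-zero ISOTROPIC row vector `ξ` with `ξ ᵥ* γ = z • ξ` (Cayley–Hamilton: `X := γ − z·1` has
  `X³ = 0`; `ξ :=` a non-zero row of `X²`, or of `X` if `X² = 0`; isotropy from the pairing identity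
  `⟨aX, ξ⟩ = ⟨aγ, ξ⟩ − z⟨a, ξ⟩ = 0` as `⟨aγ, ξ⟩ = c(z⁻¹)⟨aγ, ξγ⟩ = z⟨a, ξ⟩`, using the `U(J₃)(F)`-invariance of
  the row pairing ★ `sum_vecMul_mul_conj_vecMul_rev` of A-p13's `UnitaryGroupTruncatedKernelClassHyperbolic` —
  the unipotent companion of its hyperbolic ★ `exists_isotropic_vecMul_eq_smul_of_isRoot`, whose `α c(α) ≠ 1`
  excludes exactly this class);
* §2 **`forall_exists_conj_mem_arithmeticBorel_of_charpoly_eq_pow_three`** — hence (★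
  `exists_conj_mem_arithmeticBorel_of_vecMul_eq_smul`, Witt) EVERY `γ ∈ G(F)` of the class `(X − z)³` is
  `G(F)`-conjugate INTO `B(F)` [Rogawski1990, Prop. 3.9.1] — the `hB` letter of ★
  `truncatedKernelClass_eq_zero_of_forall_borel` for the central class;
* (sequel `UnitaryGroupUnipotentRationalBorelUnique`) **`eq_smul_single_of_vecMul_eq_smul`** — for `β ∈ B(F)` with `charpoly β = (X − z)³` and `β ≠ z·1`, every
  non-zero isotropic `ξ` with `ξ ᵥ* β = z • ξ` is a multiple of `e₃` (entrywise: `β₁₂ = −z² c(β₀₁)` by unitarity,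
  so `β₀₁ ≠ 0 ⇒ ξ₀ = ξ₁ = 0`, and `β₀₁ = 0 ⇒ β₀₂ ≠ 0 ⇒ ξ₀ = 0`, then isotropy `ξ₁ c(ξ₁) = 0`); hence
  **`mem_arithmeticBorel_of_conj_mem_of_conj_mem`**: if `δ₁ γ δ₁⁻¹ ∈ B(F)` and `δ₂ γ δ₂⁻¹ ∈ B(F)` for such a
  `γ` then `δ₂ δ₁⁻¹ ∈ B(F)` — THE rational Borel containing `γ` is unique [Rogawski1990, Prop. 7.2.1 proof].

## References

* J. D. Rogawski, *Automorphic Representations of Unitary Groups in Three Variables*, Annals of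
  Mathematics Studies 123 (1990), Prop. 3.9.1 (p. 32), Prop. 7.2.1 (pp. 91–92), §1.10 [Rogawski1990].
* J. Arthur, *A trace formula for reductive groups I*, Duke Math. J. 45 (1978), §8 [Arthur1978TraceFormulaI].
-/

set_option autoImplicit false

noncomputable section

open NumberField IsDedekindDomain Matrix Polynomial
open scoped MatrixGroups

namespace Literature.NumberTheory.Automorphic

namespace UnitaryGroup

variable {F E : Type} [Field F] [NumberField F] [Field E] [NumberField E] [Algebra F E]
  {c : E ≃ₐ[F] E}

/-! ## §1 A rational element `≠ z·1` with `charpoly = (X − z)³` has an isotropic `z`-eigen-row -/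

omit [NumberField F] [NumberField E] in
/-- Rows of a product: `(row_a A) ᵥ* B = row_a (A B)`. [folklore] [cite: Rogawski1990, §1.10] -/
private theorem row_vecMul {N : ℕ} (A B : Matrix (Fin N) (Fin N) E) (a : Fin N) :
    (fun j => A a j) ᵥ* B = fun j => (A * B) a j := by
  funext j
  simp only [Matrix.vecMul, dotProduct, Matrix.mul_apply]

/-- **Isotropy from an eigen-row**: for `γ ∈ U(J₃)(F)`, `z ∈ E¹` and row vectors `a, ξ` with
`ξ = a γ − z a` and `ξ γ = z ξ`, the row `ξ` is ISOTROPIC: `⟨ξ, ξ⟩ = ⟨aγ, ξ⟩ − z⟨a, ξ⟩` and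
`⟨aγ, ξ⟩ = z c(z) ⟨aγ, ξ⟩ = z ⟨aγ, z ξ⟩ = z ⟨aγ, ξγ⟩ = z ⟨a, ξ⟩` (§1). [cite: Rogawski1990, Prop. 3.9.1 (p. 32)] -/
theorem sum_mul_conj_rev_eq_zero_of_vecMul_eq_smul (γ : (quasiSplit F E c 3).Rational) {z : E}
    (hz : c z * z = 1) {a ξ : Fin 3 → E}
    (hξ : ξ = a ᵥ* ((γ.1 : GL (Fin 3) E) : Matrix (Fin 3) (Fin 3) E) - z • a)
    (heig : ξ ᵥ* ((γ.1 : GL (Fin 3) E) : Matrix (Fin 3) (Fin 3) E) = z • ξ) :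
    ∑ i, ξ i * c (ξ (Fin.rev i)) = 0 := by
  set M : Matrix (Fin 3) (Fin 3) E := ((γ.1 : GL (Fin 3) E) : Matrix (Fin 3) (Fin 3) E) with hM
  -- `⟨aM, ξ⟩ = z ⟨a, ξ⟩`
  have hinv := sum_vecMul_mul_conj_vecMul_rev γ a ξ
  rw [← hM, heig] at hinv
  simp only [Pi.smul_apply, smul_eq_mul, map_mul] at hinv
  have h1 : ∑ i, (a ᵥ* M) i * c (ξ (Fin.rev i)) = z * ∑ i, a i * c (ξ (Fin.rev i)) := by
    rw [← hinv, Finset.mul_sum]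
    refine Finset.sum_congr rfl fun i _ => ?_
    calc (a ᵥ* M) i * c (ξ (Fin.rev i)) = (z * c z) * ((a ᵥ* M) i * c (ξ (Fin.rev i))) := by
          rw [mul_comm z, hz, one_mul]
      _ = z * ((a ᵥ* M) i * (c z * c (ξ (Fin.rev i)))) := by ring
  -- expand the left slot `ξ = aM − z a`
  have hξi : ∀ i, ξ i = (a ᵥ* M) i - z * a i := fun i => by
    rw [hξ]; simp only [Pi.sub_apply, Pi.smul_apply, smul_eq_mul]
  calc ∑ i, ξ i * c (ξ (Fin.rev i)) = ∑ i, ((a ᵥ* M) i - z * a i) * c (ξ (Fin.rev i)) :=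
        Finset.sum_congr rfl fun i _ => by rw [hξi i]
    _ = ∑ i, (a ᵥ* M) i * c (ξ (Fin.rev i)) - z * ∑ i, a i * c (ξ (Fin.rev i)) := by
        simp only [sub_mul, Finset.sum_sub_distrib, mul_assoc, Finset.mul_sum]
    _ = 0 := by rw [h1, sub_self]

omit [NumberField F] [NumberField E] in
/-- Cayley–Hamilton for the class `(X − z)³`: `(γ − z·1)³ = 0`. [cite: Rogawski1990, §3.9 (p. 32)] -/
private theorem sub_smul_one_pow_three_eq_zero {M : Matrix (Fin 3) (Fin 3) E} {z : E}
    (hchar : M.charpoly = (X - C z) ^ 3) : (M - z • (1 : Matrix (Fin 3) (Fin 3) E)) ^ 3 = 0 := by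
  have h := Matrix.aeval_self_charpoly M
  rw [hchar, map_pow, map_sub, Polynomial.aeval_X, Polynomial.aeval_C, Algebra.algebraMap_eq_smul_one] at h
  exact h

omit [NumberField F] [NumberField E] in
/-- A row annihilated by `Y = γ − z·1` is a `z`-eigen-row of `γ`. [cite: Rogawski1990, §3.9 (p. 32)] -/
private theorem vecMul_eq_smul_of_vecMul_sub_eq_zero {M : Matrix (Fin 3) (Fin 3) E} {z : E} {ξ : Fin 3 → E}
    (h : ξ ᵥ* (M - z • (1 : Matrix (Fin 3) (Fin 3) E)) = 0) : ξ ᵥ* M = z • ξ := by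
  rw [Matrix.vecMul_sub, sub_eq_zero, Matrix.vecMul_smul, Matrix.vecMul_one] at h
  exact h

/-- **A RATIONAL `γ ≠ z·1` WITH `charpoly γ = (X − z)³` (`z ∈ E¹`) HAS A NON-ZERO ISOTROPIC `z`-EIGEN-ROW**
`ξ ≠ 0`, `⟨ξ, ξ⟩ = 0`, `ξ γ = z ξ`: with `Y = γ − z·1`, `Y³ = 0` (Cayley–Hamilton); take `ξ` a non-zero row of
`Y²` (`= (row of Y)·Y`) if `Y² ≠ 0`, else a non-zero row of `Y` (`= (row of 1)·Y`); then `ξ Y = 0` and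
`sum_mul_conj_rev_eq_zero_of_vecMul_eq_smul` gives the isotropy. For `z = 1`: every unipotent `u ≠ 1` of
`U(J₃)(F)` fixes a non-zero isotropic vector (Rogawski (1990), Prop. 3.9.1: «every unipotent element in `G` is
conjugate to an element of `N`»). [cite: Rogawski1990, Prop. 3.9.1 (p. 32)] -/
theorem exists_isotropic_vecMul_eq_smul_of_charpoly_eq (γ : (quasiSplit F E c 3).Rational) {z : E}
    (hz : c z * z = 1) (hchar : ((γ.1 : GL (Fin 3) E) : Matrix (Fin 3) (Fin 3) E).charpoly = (X - C z) ^ 3)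
    (hne : ((γ.1 : GL (Fin 3) E) : Matrix (Fin 3) (Fin 3) E) ≠ z • (1 : Matrix (Fin 3) (Fin 3) E)) :
    ∃ ξ : Fin 3 → E, ξ ≠ 0 ∧ ∑ i, ξ i * c (ξ (Fin.rev i)) = 0 ∧
      ξ ᵥ* ((γ.1 : GL (Fin 3) E) : Matrix (Fin 3) (Fin 3) E) = z • ξ := by
  set M : Matrix (Fin 3) (Fin 3) E := ((γ.1 : GL (Fin 3) E) : Matrix (Fin 3) (Fin 3) E) with hM
  set Y : Matrix (Fin 3) (Fin 3) E := M - z • (1 : Matrix (Fin 3) (Fin 3) E) with hY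
  have hY3 : Y ^ 3 = 0 := sub_smul_one_pow_three_eq_zero hchar
  have hY0 : Y ≠ 0 := fun h => hne (sub_eq_zero.1 h)
  by_cases hY2 : Y * Y = 0
  · -- `ξ` = a non-zero row of `Y`
    obtain ⟨i, j, hij⟩ : ∃ i j, Y i j ≠ 0 := by
      by_contra h
      push Not at h
      exact hY0 (Matrix.ext fun i j => h i j)
    refine ⟨fun k => Y i k, fun h => hij (by simpa using congrFun h j), ?_, ?_⟩
    · refine sum_mul_conj_rev_eq_zero_of_vecMul_eq_smul γ hz (a := fun k => (1 : Matrix (Fin 3) (Fin 3) E) i k)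
        ?_ (vecMul_eq_smul_of_vecMul_sub_eq_zero ?_)
      · rw [row_vecMul, Matrix.one_mul]
        funext k
        simp only [hY, Matrix.sub_apply, Matrix.smul_apply, Pi.sub_apply, Pi.smul_apply, smul_eq_mul]
        rfl
      · rw [← hY, row_vecMul, hY2]; rfl
    · exact vecMul_eq_smul_of_vecMul_sub_eq_zero (by rw [← hY, row_vecMul, hY2]; rfl)
  · -- `ξ` = a non-zero row of `Y²`
    obtain ⟨i, j, hij⟩ : ∃ i j, (Y * Y) i j ≠ 0 := by
      by_contra h
      push Not at h
      exact hY2 (Matrix.ext fun i j => h i j)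
    have hY3' : Y * Y * Y = 0 := by rw [← hY3, pow_three, Matrix.mul_assoc]
    refine ⟨fun k => (Y * Y) i k, fun h => hij (by simpa using congrFun h j), ?_, ?_⟩
    · refine sum_mul_conj_rev_eq_zero_of_vecMul_eq_smul γ hz (a := fun k => Y i k) ?_
        (vecMul_eq_smul_of_vecMul_sub_eq_zero ?_)
      · rw [row_vecMul]
        funext k
        have : Y * Y = Y * M - z • Y := by
          rw [hY, Matrix.mul_sub, Matrix.mul_smul, Matrix.mul_one]
        rw [this]
        simp only [Matrix.sub_apply, Matrix.smul_apply, Pi.sub_apply, Pi.smul_apply, smul_eq_mul]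
        rfl
      · rw [← hY, row_vecMul, hY3']; rfl
    · exact vecMul_eq_smul_of_vecMul_sub_eq_zero (by rw [← hY, row_vecMul, hY3']; rfl)


/-- The rational characteristic polynomial of a representative of `γ ∈ G(F)` from the adelic one (★
`charpoly_adelicVal_toAdelic`, injectivity of `E → 𝔸_E`). [cite: Rogawski1990, §2.2 (p. 13)] -/
theorem charpoly_eq_of_toAdelic_eq {N : ℕ} {γ : (quasiSplit F E c N).arithmeticSubgroup}
    {γ₀ : (quasiSplit F E c N).Rational} (hγ₀ : (quasiSplit F E c N).toAdelic γ₀ = γ) {p : E[X]}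
    (hchar : ((adelicVal F E c N _ (γ : (quasiSplit F E c N).Adelic) : GL (Fin N) (AdeleRing (𝓞 E) E)) :
        Matrix (Fin N) (Fin N) (AdeleRing (𝓞 E) E)).charpoly = p.map (algebraMap E (AdeleRing (𝓞 E) E))) :
    ((γ₀.1 : GL (Fin N) E) : Matrix (Fin N) (Fin N) E).charpoly = p := by
  rw [← hγ₀, charpoly_adelicVal_toAdelic] at hchar
  exact Polynomial.map_injective _ (AdeleRing.algebraMap_injective (𝓞 E) E) hchar

/-! ## §2 Every element of the class `(X − z)³` is `G(F)`-conjugate into `B(F)` -/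

/-- **EVERY RATIONAL ELEMENT OF THE CLASS `(X − z)³`, `z ∈ E¹`, IS `G(F)`-CONJUGATE INTO THE RATIONAL BOREL**:
if `charpoly γ = (X − z)³ ⊗ 𝔸_E` then `δ γ δ⁻¹ ∈ B(F)` for some `δ ∈ G(F)` (`γ = z·1`: `δ = 1`; else §1's isotropic
`z`-eigen-row and ★ `exists_conj_mem_arithmeticBorel_of_vecMul_eq_smul` — Witt + «`B` = stabiliser of `F e₃`»).
For `z = 1`: every unipotent element of `U(J₃)(F)` lies in a rational Borel subgroup, i.e. is conjugate to an
element of `N(F)` (Rogawski (1990), Prop. 3.9.1; rank one). This is the letter `hB` of ★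
`truncatedKernelClass_eq_zero_of_forall_borel` (`UnitaryGroupTruncatedKernelClassHyperbolic` §1) for the class (i)
`((X − z)³).map` of ★ `meetsBorel_trichotomy`. [cite: Rogawski1990, Prop. 3.9.1 (p. 32)] -/
theorem forall_exists_conj_mem_arithmeticBorel_of_charpoly_eq_pow_three (hc : c * c = 1) {z : E}
    (hz : c z * z = 1) :
    ∀ γ : (quasiSplit F E c 3).arithmeticSubgroup,
      ((adelicVal F E c 3 _ (γ : (quasiSplit F E c 3).Adelic) : GL (Fin 3) (AdeleRing (𝓞 E) E)) :
          Matrix (Fin 3) (Fin 3) (AdeleRing (𝓞 E) E)).charpoly =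
        ((X - C z) ^ 3).map (algebraMap E (AdeleRing (𝓞 E) E)) →
      ∃ δ : (quasiSplit F E c 3).arithmeticSubgroup, δ * γ * δ⁻¹ ∈ arithmeticBorel F E c 3 := by
  intro γ hchar
  obtain ⟨γ₀, hγ₀⟩ := γ.2
  have hchar₀ := charpoly_eq_of_toAdelic_eq hγ₀ hchar
  by_cases hcen : ((γ₀.1 : GL (Fin 3) E) : Matrix (Fin 3) (Fin 3) E) = z • (1 : Matrix (Fin 3) (Fin 3) E)
  · -- `γ = z·1` is diagonal, hence in `B(F)`
    refine ⟨1, ?_⟩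
    rw [one_mul, inv_one, mul_one, mem_arithmeticBorel_iff, ← hγ₀, toAdelic_mem_borelAdelic_iff, hcen]
    intro i j hij
    have hij' : i ≠ j := ne_of_gt hij
    simp [hij']
  · obtain ⟨ξ, hξ0, hiso, heig⟩ := exists_isotropic_vecMul_eq_smul_of_charpoly_eq γ₀ hz hchar₀ hcen
    obtain ⟨δ, hδ⟩ := exists_conj_mem_arithmeticBorel_of_vecMul_eq_smul hc γ₀ hξ0 hiso heig
    refine ⟨⟨(quasiSplit F E c 3).toAdelic δ, δ, rfl⟩, ?_⟩
    rw [mem_arithmeticBorel_iff]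
    have hval : (((⟨(quasiSplit F E c 3).toAdelic δ, δ, rfl⟩ : (quasiSplit F E c 3).arithmeticSubgroup) * γ *
        (⟨(quasiSplit F E c 3).toAdelic δ, δ, rfl⟩ : (quasiSplit F E c 3).arithmeticSubgroup)⁻¹ :
          (quasiSplit F E c 3).arithmeticSubgroup) : (quasiSplit F E c 3).Adelic) =
        (quasiSplit F E c 3).toAdelic (δ * γ₀ * δ⁻¹) := by
      rw [map_mul, map_mul, map_inv, hγ₀]
      rfl
    rw [hval]
    exact hδ

end UnitaryGroup

end Literature.NumberTheory.Automorphic
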